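import Mathlib
import Literature.NumberTheory.LFunctions.FeketePolynomial
import Literature.RingTheory.Valuation.AlgClosedResidue
import Literature.RingTheory.Valuation.RootReduction
import Summits.ValiantsHypothesis.ValiantsHypothesis.Theses.FeketeSOS
import Summits.ValiantsHypothesis.ValiantsHypothesis.Theorems.FeketeSOSDepthZeroShadow
import Summits.ValiantsHypothesis.ValiantsHypothesis.Theorems.FeketeSOSSublinearShadowGramShadow

/-!
# `FeketeSOS.SublinearShadow` (stmt-ValiantsHypothesis-14990), line `Sketch`, reshape 7 — `stub_isotropicLiftShadow`

**Isotropic lifts de-border unit-deep Gram data (re-association).**  Every transfer landed so far for this crux reads a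
representation of `F_p` through a ring map `O → K[T]/(T^{v+1})` and therefore sees nothing of a UNIT-DEEP Gram datum
(`θ ≥ e`: the map kills `p`).  The present lemma is the first mechanism that starts from unit-deep data.  Let `O ⊂ ℂ` be a
valuation subring with `p ∈ 𝔪_O` (`p` odd), and suppose the cleared Gram form of a representation is

  `w · F_p = Σ_{j,j'<r} B_{jj'} h_j h_{j'}`,   `B ∈ O^{r×r}`, `w ∈ O ∖ {0}` (e.g. `w = π^θ`, any depth `θ`),

and that the basis admits an INTEGRAL ISOTROPIC LIFT to full depth: `h_j = H_j + w ρ_j` with `H_j, ρ_j ∈ O[X]` and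
`Σ B_{jj'} H_j H_{j'} = 0` exactly.  Then, cancelling `w`,

  `F_p = Σ B_{jj'} (H_j ρ_{j'} + ρ_j H_{j'}) + w Σ B_{jj'} ρ_j ρ_{j'}`

is an `O`-INTEGRAL quadratic form (block matrix `[[0, B], [B, wB]]`) in the `2r` integral polynomials `(H, ρ)` — a
depth-zero representation of `F_p` manufactured from a unit-deep one.  Reducing modulo `𝔪_O`, polarising into `2(2r)² = 8r²`
weighted squares (`stub_qfSquares`) and folding exponents modulo `p` gives a cyclic characteristic-`p` shadow with `≤ 8r²`
squares of degree `< p` and total support `≤ 8r² · Σ_j (|supp H_j| + |supp ρ_j|)`.  For `r = 3` and `B` the split form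
`y₁y₃ − y₂²` the lift is a cone point `D·(M², MN, N²)` congruent to `h` modulo `w`; the cost is governed by the sparsity
of the lift, not by the depth.  (What remains open is the EXISTENCE of sparse integral isotropic lifts to full depth:
modulo `𝔪_O` a lift with the supports of the characteristic-`p` conic parametrisation always exists; higher congruence is
the liftability question of the dossier `Cruxes/SublinearShadow/Lines/Sketch-dead.md` §4 item 2.)
-/

namespace Summit.ValiantsHypothesis.ValiantsHypothesis.Theorems.SublinearShadowSketch

open Polynomial Finset IsLocalRing Matrix
open scoped BigOperators
open Literature.NumberTheory.LFunctions
open Literature.RingTheory.Valuation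

-- `Summit.ValiantsHypothesis.ValiantsHypothesis.…` is the tree's mandated single-conjunct layout (Sub = Summit).
set_option linter.dupNamespace false

/-- **Re-association identity.**  From `w·F = Σ B_{jj'} (H_j + w ρ_j)(H_{j'} + w ρ_{j'})`, `Σ B_{jj'} H_j H_{j'} = 0` and
`w ≠ 0`:  `F = Σ_{J,J'} M_{JJ'} q_J q_{J'}` with `q = (H, ρ)` and `M = [[0, B], [B, wB]]` the block matrix on `Fin r ⊕ Fin r`. -/
theorem ils_identity {r : ℕ} (B : Fin r → Fin r → ℂ) (w : ℂ) (hw0 : w ≠ 0) (H ρ : Fin r → ℂ[X]) (F : ℂ[X])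
    (hiso : (∑ j, ∑ j', C (B j j') * (H j * H j')) = 0)
    (hrep : C w * F = ∑ j, ∑ j', C (B j j') * ((H j + C w * ρ j) * (H j' + C w * ρ j'))) :
    F = ∑ J : Fin r ⊕ Fin r, ∑ J' : Fin r ⊕ Fin r,
      C (Sum.elim (fun j => Sum.elim (fun _ => (0 : ℂ)) (fun j' => B j j'))
          (fun j => Sum.elim (fun j' => B j j') (fun j' => w * B j j')) J J')
        * (Sum.elim H ρ J * Sum.elim H ρ J') := by
  -- expand the right-hand side of `hrep`
  have hexp : (∑ j, ∑ j', C (B j j') * ((H j + C w * ρ j) * (H j' + C w * ρ j')))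
      = (∑ j, ∑ j', C (B j j') * (H j * H j'))
        + C w * ((∑ j, ∑ j', C (B j j') * (H j * ρ j')) + (∑ j, ∑ j', C (B j j') * (ρ j * H j'))
            + ∑ j, ∑ j', C (w * B j j') * (ρ j * ρ j')) := by
    simp only [Finset.mul_sum, mul_add, ← Finset.sum_add_distrib]
    refine Finset.sum_congr rfl fun j _ => Finset.sum_congr rfl fun j' _ => ?_
    simp only [C_mul]
    ring
  rw [hexp, hiso, zero_add] at hrep
  have hF : F = (∑ j, ∑ j', C (B j j') * (H j * ρ j')) + (∑ j, ∑ j', C (B j j') * (ρ j * H j'))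
      + ∑ j, ∑ j', C (w * B j j') * (ρ j * ρ j') :=
    mul_left_cancel₀ (Polynomial.C_ne_zero.mpr hw0) hrep
  -- split the block sum
  rw [hF, Fintype.sum_sum_type]
  simp only [Fintype.sum_sum_type, Sum.elim_inl, Sum.elim_inr, map_zero, zero_mul,
    Finset.sum_const_zero, zero_add, Finset.sum_add_distrib]
  abel

/-- **`stub_isotropicLiftShadow` (registered stub of line `Sketch`, reshape 7): isotropic lifts de-border unit-deep Gram data.**
Let `O ⊂ ℂ` be a valuation subring with `p ∈ 𝔪_O` (`p` odd), `B ∈ O^{r×r}`, `w ∈ O ∖ {0}`, and `H_j, ρ_j ∈ O[X]` (`j < r`) with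
`Σ B_{jj'} H_j H_{j'} = 0` and `w · F_p = Σ B_{jj'} (H_j + w ρ_j)(H_{j'} + w ρ_{j'})`.  Then `F̄_p` has a cyclic characteristic-`p`
shadow with `≤ 8r²` weighted squares of degree `< p` and total support `≤ 8r² · Σ_j (|supp H_j| + |supp ρ_j|)`. -/
theorem stub_isotropicLiftShadow (p : ℕ) [Fact p.Prime] (hp2 : p ≠ 2) (O : ValuationSubring ℂ)
    (hpO : ((p : ℕ) : O) ∈ maximalIdeal O) (r : ℕ) (B : Fin r → Fin r → ℂ) (hB : ∀ j j', B j j' ∈ O)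
    (w : ℂ) (hw : w ∈ O) (hw0 : w ≠ 0) (H ρ : Fin r → ℂ[X])
    (hH : ∀ j n, (H j).coeff n ∈ O) (hρ : ∀ j n, (ρ j).coeff n ∈ O)
    (hiso : (∑ j, ∑ j', C (B j j') * (H j * H j')) = 0)
    (hrep : C w * (∑ m ∈ Finset.range p, C ((legendreSym p m : ℤ) : ℂ) * X ^ m)
        = ∑ j, ∑ j', C (B j j') * ((H j + C w * ρ j) * (H j' + C w * ρ j'))) :
    ∃ (K : Type) (_ : Field K) (_ : CharP K p) (d : ℕ) (c' : Fin d → K) (g' : Fin d → Polynomial K),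
      d ≤ 8 * (r * r) ∧ (∀ j, (g' j).natDegree < p) ∧
      (∑ j, (g' j).support.card) ≤ 8 * (r * r) * ∑ j, ((H j).support.card + (ρ j).support.card) ∧
      ((X : Polynomial K) ^ p - 1 ∣ (∑ j, C (c' j) * g' j ^ 2)
        - ∑ m ∈ Finset.range p, C ((legendreSym p m : ℤ) : K) * X ^ m) := by
  classical
  have hprime : p.Prime := Fact.out
  have hp0 : 0 < p := hprime.pos
  haveI hchar : CharP (ResidueField O) p := charP_residueField O hpO
  set ι : O →+* ℂ := algebraMap O ℂ with hι
  have hιinj : Function.Injective ι := IsFractionRing.injective O ℂ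
  set ρK : O →+* ResidueField O := residue O with hρK
  -- (1) the re-association identity over `ℂ`, transported to `Fin (r + r)`
  set e : Fin r ⊕ Fin r ≃ Fin (r + r) := finSumFinEquiv with he
  set R : ℕ := r + r with hR
  set q : Fin R → ℂ[X] := fun J => Sum.elim H ρ (e.symm J) with hq
  set M : Fin R → Fin R → ℂ := fun J J' =>
    Sum.elim (fun j => Sum.elim (fun _ => (0 : ℂ)) (fun j' => B j j'))
      (fun j => Sum.elim (fun j' => B j j') (fun j' => w * B j j')) (e.symm J) (e.symm J') with hM
  have hident : (∑ m ∈ Finset.range p, C ((legendreSym p m : ℤ) : ℂ) * X ^ m)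
      = ∑ J, ∑ J', C (M J J') * (q J * q J') := by
    rw [ils_identity B w hw0 H ρ _ hiso hrep]
    rw [← e.symm.sum_comp]
    refine Finset.sum_congr rfl fun J _ => ?_
    rw [← e.symm.sum_comp]
  have hMint : ∀ J J', M J J' ∈ O := fun J J' => by
    simp only [hM]
    rcases e.symm J with j | j <;> rcases e.symm J' with j' | j' <;>
      simp only [Sum.elim_inl, Sum.elim_inr]
    · exact zero_mem O
    · exact hB j j'
    · exact hB j j'
    · exact mul_mem hw (hB j j')
  have hqint : ∀ J n, (q J).coeff n ∈ O := fun J n => by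
    simp only [hq]
    rcases e.symm J with j | j
    · exact hH j n
    · exact hρ j n
  -- the union of all supports
  set U : Finset ℕ := Finset.univ.biUnion fun j : Fin r => (H j).support ∪ (ρ j).support with hU
  have hUcard : U.card ≤ ∑ j, ((H j).support.card + (ρ j).support.card) :=
    Finset.card_biUnion_le.trans (Finset.sum_le_sum fun j _ => Finset.card_union_le _ _)
  have hqsupp : ∀ J, (q J).support ⊆ U := fun J => by
    simp only [hq]
    rcases e.symm J with j | j
    · exact fun n hn => Finset.mem_biUnion.mpr ⟨j, Finset.mem_univ _, Finset.mem_union_left _ hn⟩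
    · exact fun n hn => Finset.mem_biUnion.mpr ⟨j, Finset.mem_univ _, Finset.mem_union_right _ hn⟩
  -- (2) lift to `O[X]` and push to the residue field
  choose Q hQ hQsupp using fun J => dzs_exists_lift O (hqint J)
  set MO : Fin R → Fin R → O := fun J J' => ⟨M J J', hMint J J'⟩ with hMO
  have hFmap : ∀ (A S : Type) [CommRing A] [CommRing S] (f : A →+* S),
      ((feketePolynomial p).map (Int.castRingHom A)).map f
        = (feketePolynomial p).map (Int.castRingHom S) := fun A S _ _ f => by
    rw [Polynomial.map_map, RingHom.ext_int (f.comp (Int.castRingHom A)) (Int.castRingHom S)]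
  have hFK : (feketePolynomial p).map (Int.castRingHom (ResidueField O)) =
      ∑ m ∈ Finset.range p, C ((legendreSym p m : ℤ) : ResidueField O) * X ^ m := by
    simp only [map_feketePolynomial, eq_intCast]
  have hrepO : (∑ J, ∑ J', C (MO J J') * (Q J * Q J')) = (feketePolynomial p).map (Int.castRingHom O) := by
    apply Polynomial.map_injective ι hιinj
    rw [hFmap O ℂ ι, map_feketePolynomial_complex, hident, Polynomial.map_sum]
    refine Finset.sum_congr rfl fun J _ => ?_
    rw [Polynomial.map_sum]
    refine Finset.sum_congr rfl fun J' _ => ?_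
    rw [Polynomial.map_mul, Polynomial.map_mul, map_C, hQ, hQ]
    rfl
  set Mk : Fin R → Fin R → ResidueField O := fun J J' => ρK (MO J J') with hMk
  set qk : Fin R → (ResidueField O)[X] := fun J => (Q J).map ρK with hqk
  have hrepK : (∑ J, ∑ J', C (Mk J J') * (qk J * qk J')) =
      (feketePolynomial p).map (Int.castRingHom (ResidueField O)) := by
    rw [← hFmap O (ResidueField O) ρK, ← hrepO, Polynomial.map_sum]
    refine Finset.sum_congr rfl fun J _ => ?_
    rw [Polynomial.map_sum]
    refine Finset.sum_congr rfl fun J' _ => ?_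
    rw [Polynomial.map_mul, Polynomial.map_mul, map_C]
  have hqksupp : ∀ J, (qk J).support ⊆ U := fun J =>
    (support_map_subset _ _).trans (by rw [hQsupp J]; exact hqsupp J)
  -- (3) polarise into `2R²` weighted squares over the residue field
  have h2k : (2 : ResidueField O) ≠ 0 := gsh_two_ne_zero_residue O hprime hp2 hpO
  obtain ⟨c', g', hsq, hsqsupp⟩ := stub_qfSquares (ResidueField O) h2k R Mk qk
  have hg'supp : ∀ k, (g' k).support ⊆ U := fun k => by
    obtain ⟨J, J', hk⟩ := hsqsupp k
    exact hk.trans (Finset.union_subset (hqksupp J) (hqksupp J'))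
  -- (4) fold cyclically and assemble
  obtain ⟨g'', hg''⟩ : ∃ g'' : Fin (2 * (R * R)) → (ResidueField O)[X],
      ∀ k, g'' k = ∑ n ∈ (g' k).support, C ((g' k).coeff n) * X ^ (n % p) := ⟨_, fun _ => rfl⟩
  have hg''deg : ∀ k, (g'' k).natDegree < p := fun k => by
    rw [hg'' k]; exact dzs_natDegree_fold_lt (g' k) hp0
  have hg''supp : ∀ k, (g'' k).support.card ≤ U.card := fun k => by
    rw [hg'' k]
    exact (dzs_card_support_fold_le (g' k) p).trans (Finset.card_le_card (hg'supp k))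
  have hg''dvd : ∀ k, (X : (ResidueField O)[X]) ^ p - 1 ∣ g'' k - g' k := fun k => by
    rw [hg'' k]; exact dzs_X_pow_sub_one_dvd_fold_sub (g' k) p
  have hfin : (X : (ResidueField O)[X]) ^ p - 1 ∣
      (∑ k, C (c' k) * g'' k ^ 2) - ∑ m ∈ Finset.range p, C ((legendreSym p m : ℤ) : ResidueField O) * X ^ m := by
    have h := dzs_dvd_sum_sq_sub c' g' g'' _ (hsq.trans hrepK) hg''dvd
    rw [hFK] at h
    exact h
  have hRR : 2 * (R * R) = 8 * (r * r) := by rw [hR]; ring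
  refine ⟨ResidueField O, inferInstance, hchar, 2 * (R * R), c', g'', le_of_eq hRR, hg''deg, ?_, hfin⟩
  calc (∑ k, (g'' k).support.card) ≤ ∑ _k : Fin (2 * (R * R)), U.card := Finset.sum_le_sum fun k _ => hg''supp k
    _ = 2 * (R * R) * U.card := by simp
    _ ≤ 8 * (r * r) * ∑ j, ((H j).support.card + (ρ j).support.card) := by
        rw [hRR]; exact Nat.mul_le_mul_left _ hUcard

end Summit.ValiantsHypothesis.ValiantsHypothesis.Theorems.SublinearShadowSketch
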